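import Summits.HodgeConjecture.HodgeConjecture.Theorems.TropicalWeilObstructionTropicalHodgeBoundFramePairing
import Literature.AlgebraicGeometry.Tropical.TorusCycles

/-!
# Crux `TropicalHodgeBound` (stmt-HodgeConjecture-18480), stub 4 — part G1: the entries of a
# `J`-commuting symmetric period matrix in terms of its `16` free entries

Route `TropicalWeilObstruction` of `HodgeConjecture`, registered line `birth`
(`Cruxes/TropicalHodgeBound/Lines/birth.lean`), stub `stub_rationalHodgeCoordinates`; ingredient (G),
the genericity transfer. A symmetric real `8 × 8` matrix `Q` commuting with `J = weilJ 4` has the block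
form `Q = [[A, B], [-B, A]]` (`A` symmetric, `B` antisymmetric; Zharkov §2), so every entry is `0` or
`±` one of the `16` FREE entries indexed by `weilFreeIndex 4` (upper triangle of `A` with the diagonal,
strict upper triangle of `B`). This file makes that bookkeeping explicit and COMPUTABLE (it is reused by
the kernel-run certificate checker):

* `entrySign α β ∈ {0, 1, -1}` and `entryVar α β : Fin 8 × Fin 8` (always a free index,
  `entryVar_free`) with `Q α β = entrySign α β · Q (entryVar α β)` (`entry_eq`);
* `symEntry α β = monomial (X_{entryVar α β}) (entrySign α β)` in `MvPolynomial (weilFreeIndex 4) ℚ`, with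
  `aeval t (symEntry α β) = Q α β` for `t` = the free entries of `Q` (`aeval_symEntry`), hence
  `det Q[K, I] = aeval t (det (symEntry)[K, I])` (`det_submatrix_eq_aeval`).

No named fact, no sorry.

References: [Zharkov2020TropicalWeil] I. Zharkov, Tropical abelian varieties, Weil classes and the Hodge
conjecture, arXiv:2002.02347, §2; [MikhalkinZharkov2014Eigenwave] G. Mikhalkin, I. Zharkov, LN UMI 15
(2014), Def. 6.1.
-/

set_option linter.dupNamespace false

namespace Summit.HodgeConjecture.HodgeConjecture.Theorems.TropicalHodgeBound

open scoped BigOperators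
open Matrix Literature.AlgebraicGeometry.Tropical

section Entries

/-- The residue of an index of `Fin 8` modulo the half `4` (its position inside the `A`/`B` block).
[folklore] -/
def loPart (α : Fin 8) : Fin 4 := ⟨(α : ℕ) % 4, Nat.mod_lt _ (by decide)⟩

/-- Whether an index of `Fin 8` lies in the top half `{0,1,2,3}`. [folklore] -/
def isTop (α : Fin 8) : Bool := decide ((α : ℕ) < 4)

/-- The sign `∈ {0, 1, -1}` with which the entry `(α, β)` of `Q = [[A,B],[-B,A]]` equals a free entry.
[cite: Zharkov2020TropicalWeil, §2] -/
def entrySign (α β : Fin 8) : ℤ :=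
  if isTop α = isTop β then 1
  else if loPart α < loPart β then (if isTop α then 1 else -1)
  else if loPart β < loPart α then (if isTop α then -1 else 1)
  else 0

/-- The free index (`weilFreeIndex 4`, as a pair) whose entry `± Q α β` is: `A_{min,max}` for the diagonal
blocks, `B_{a,b}` (`a < b`) for the off-diagonal blocks; `(0,0)` (harmless) for the zero entries
`B_{a,a}`. [cite: Zharkov2020TropicalWeil, §2] -/
def entryVar (α β : Fin 8) : Fin 8 × Fin 8 :=
  if isTop α = isTop β then
    (Fin.castAdd 4 (min (loPart α) (loPart β)), Fin.castAdd 4 (max (loPart α) (loPart β)))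
  else if loPart α < loPart β then (Fin.castAdd 4 (loPart α), Fin.natAdd 4 (loPart β))
  else if loPart β < loPart α then (Fin.castAdd 4 (loPart β), Fin.natAdd 4 (loPart α))
  else ((0 : Fin 8), (0 : Fin 8))

/-- `entryVar` always lands in the free indices (the defining condition of `weilFreeIndex 4`).
[cite: Zharkov2020TropicalWeil, §2] -/
theorem entryVar_free : ∀ α β : Fin 8,
    ((entryVar α β).1 : ℕ) ≤ (entryVar α β).2 ∧ (((entryVar α β).2 : ℕ) < 4 ∨
      (((entryVar α β).1 : ℕ) < 4 ∧ ((entryVar α β).1 : ℕ) + 4 < (entryVar α β).2)) := by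
  decide

/-- `entryVar α β` as an element of `weilFreeIndex 4`. [cite: Zharkov2020TropicalWeil, §2] -/
def entryIdx (α β : Fin 8) : weilFreeIndex 4 := ⟨entryVar α β, entryVar_free α β⟩

/-! ### `Q α β = entrySign α β · Q (entryVar α β)` -/

variable (Q : Matrix (Fin (2 * 4)) (Fin (2 * 4)) ℝ)

/-- A top-half index is top. [folklore] -/
theorem isTop_castAdd (a : Fin 4) : isTop (Fin.castAdd 4 a) = true := by
  simp [isTop, a.is_lt]

/-- A bottom-half index is not top. [folklore] -/
theorem isTop_natAdd (a : Fin 4) : isTop (Fin.natAdd 4 a) = false := by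
  simp [isTop]

/-- The residue of a top-half index. [folklore] -/
theorem loPart_castAdd (a : Fin 4) : loPart (Fin.castAdd 4 a) = a := by
  ext; simp [loPart, Nat.mod_eq_of_lt a.is_lt]

/-- The residue of a bottom-half index. [folklore] -/
theorem loPart_natAdd (a : Fin 4) : loPart (Fin.natAdd 4 a) = a := by
  ext; simp [loPart, Nat.mod_eq_of_lt a.is_lt]

/-- `castAdd 4 a = ⟨a, _⟩` (the index form of the `…FramePairing` lemmas). [folklore] -/
theorem castAdd_eq_mk (a : Fin 4) : Fin.castAdd 4 a = (⟨(a : ℕ), by omega⟩ : Fin (2 * 4)) := by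
  ext; simp

/-- `natAdd 4 a = ⟨a + 4, _⟩` (the index form of the `…FramePairing` lemmas). [folklore] -/
theorem natAdd_eq_mk (a : Fin 4) : Fin.natAdd 4 a = (⟨(a : ℕ) + 4, by omega⟩ : Fin (2 * 4)) :=
  Fin.ext (by simp only [Fin.val_natAdd]; omega)

/-- Every index of `Fin 8` is `castAdd 4 a` (top half) or `natAdd 4 a` (bottom half). [folklore] -/
theorem fin8_cases (α : Fin (2 * 4)) :
    (∃ a : Fin 4, α = Fin.castAdd 4 a) ∨ (∃ a : Fin 4, α = Fin.natAdd 4 a) := by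
  by_cases h : (α : ℕ) < 4
  · exact Or.inl ⟨⟨α, h⟩, Fin.ext rfl⟩
  · exact Or.inr ⟨⟨(α : ℕ) - 4, by omega⟩, Fin.ext (by simp only [Fin.val_natAdd]; omega)⟩

variable {Q}

/-- From `QJ = JQ`: the bottom-right block equals the top-left block. [cite: Zharkov2020TropicalWeil, §2] -/
theorem entry_hi_hi (hJ : Q * weilJ 4 = weilJ 4 * Q) (a b : Fin 4) :
    Q (Fin.natAdd 4 a) (Fin.natAdd 4 b) = Q (Fin.castAdd 4 a) (Fin.castAdd 4 b) := by
  have h := congrFun (congrFun hJ ⟨(a : ℕ), by omega⟩) ⟨(b : ℕ) + 4, by omega⟩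
  rw [mul_weilJ_apply_hi, weilJ_mul_apply_lo] at h
  rw [natAdd_eq_mk, natAdd_eq_mk, castAdd_eq_mk, castAdd_eq_mk]
  linarith

/-- From `QJ = JQ`: the top-right block is minus the bottom-left block. [cite: Zharkov2020TropicalWeil, §2] -/
theorem entry_lo_hi (hJ : Q * weilJ 4 = weilJ 4 * Q) (a b : Fin 4) :
    Q (Fin.castAdd 4 a) (Fin.natAdd 4 b) = - Q (Fin.natAdd 4 a) (Fin.castAdd 4 b) := by
  have h := congrFun (congrFun hJ ⟨(a : ℕ), by omega⟩) ⟨(b : ℕ), by omega⟩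
  rw [mul_weilJ_apply_lo, weilJ_mul_apply_lo] at h
  rw [natAdd_eq_mk, natAdd_eq_mk, castAdd_eq_mk, castAdd_eq_mk]
  linarith

/-- **Every entry of a symmetric `J`-commuting `Q` is `0` or `±` a free entry**:
`Q α β = entrySign α β · Q (entryVar α β)`. [cite: Zharkov2020TropicalWeil, §2] -/
theorem entry_eq (hS : ∀ α β, Q α β = Q β α) (hJ : Q * weilJ 4 = weilJ 4 * Q) (α β : Fin (2 * 4)) :
    Q α β = (entrySign α β : ℝ) * Q (entryVar α β).1 (entryVar α β).2 := by
  rcases fin8_cases α with ⟨a, rfl⟩ | ⟨a, rfl⟩ <;> rcases fin8_cases β with ⟨b, rfl⟩ | ⟨b, rfl⟩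
  · -- top-left block `A`
    simp only [entrySign, entryVar, isTop_castAdd, loPart_castAdd, if_true, Int.cast_one, one_mul]
    rcases le_total a b with h | h
    · rw [min_eq_left h, max_eq_right h]
    · rw [min_eq_right h, max_eq_left h, hS]
  · -- top-right block `B`
    simp only [entrySign, entryVar, isTop_castAdd, isTop_natAdd, loPart_castAdd, loPart_natAdd,
      Bool.true_eq_false, if_false, if_true]
    rcases lt_trichotomy a b with h | h | h
    · rw [if_pos h, if_pos h]; simp
    · subst h
      rw [if_neg (lt_irrefl a), if_neg (lt_irrefl a), if_neg (lt_irrefl a), if_neg (lt_irrefl a)]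
      have h1 := entry_lo_hi hJ a a
      rw [hS (Fin.natAdd 4 a)] at h1
      simp only [Int.cast_zero, zero_mul]
      linarith
    · rw [if_neg (not_lt.mpr h.le), if_neg (not_lt.mpr h.le), if_pos h, if_pos h,
        entry_lo_hi hJ a b, hS (Fin.natAdd 4 a), entry_lo_hi hJ b a, hS (Fin.natAdd 4 b)]
      simp
  · -- bottom-left block `-B`
    simp only [entrySign, entryVar, isTop_castAdd, isTop_natAdd, loPart_castAdd, loPart_natAdd,
      Bool.false_eq_true, if_false]
    rcases lt_trichotomy a b with h | h | h
    · rw [if_pos h, if_pos h, hS, entry_lo_hi hJ b a, hS (Fin.natAdd 4 b)]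
      simp
    · subst h
      rw [if_neg (lt_irrefl a), if_neg (lt_irrefl a), if_neg (lt_irrefl a), if_neg (lt_irrefl a)]
      have h1 := entry_lo_hi hJ a a
      rw [hS (Fin.natAdd 4 a)] at h1
      simp only [Int.cast_zero, zero_mul]
      rw [hS]
      linarith
    · rw [if_neg (not_lt.mpr h.le), if_neg (not_lt.mpr h.le), if_pos h, if_pos h, hS,
        entry_lo_hi hJ b a]
      simp
  · -- bottom-right block `A`
    simp only [entrySign, entryVar, isTop_natAdd, loPart_natAdd, if_true, Int.cast_one, one_mul,
      entry_hi_hi hJ]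
    rcases le_total a b with h | h
    · rw [min_eq_left h, max_eq_right h]
    · rw [min_eq_right h, max_eq_left h, hS]

/-! ### The symbolic period matrix over `ℚ[weilFreeIndex 4]` -/

/-- The `(α, β)` entry of the symbolic period matrix: the monomial `entrySign α β · X_{entryVar α β}`.
[cite: Zharkov2020TropicalWeil, §2] -/
noncomputable def symEntry (α β : Fin (2 * 4)) : MvPolynomial (weilFreeIndex 4) ℚ :=
  MvPolynomial.monomial (Finsupp.single (entryIdx α β) 1) (entrySign α β : ℚ)

/-- The free entries of `Q`, the point at which the symbolic matrix is evaluated.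
[cite: Zharkov2020TropicalWeil, §2] -/
def freeEntries (Q : Matrix (Fin (2 * 4)) (Fin (2 * 4)) ℝ) : weilFreeIndex 4 → ℝ :=
  fun ab => Q ab.1.1 ab.1.2

/-- `aeval` of a symbolic entry at the free entries of `Q` is the entry of `Q`.
[cite: Zharkov2020TropicalWeil, §2] -/
theorem aeval_symEntry (hS : ∀ α β, Q α β = Q β α) (hJ : Q * weilJ 4 = weilJ 4 * Q) (α β : Fin (2 * 4)) :
    MvPolynomial.aeval (freeEntries Q) (symEntry α β) = Q α β := by
  rw [symEntry, MvPolynomial.aeval_monomial, Finsupp.prod_single_index (by simp), pow_one,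
    entry_eq hS hJ α β]
  simp [freeEntries, entryIdx]

/-- **Minors of `Q` are evaluations of symbolic minors**: `det Q[K, I] = aeval t (det (symEntry)[K, I])`.
[cite: Zharkov2020TropicalWeil, §2] -/
theorem det_submatrix_eq_aeval (hS : ∀ α β, Q α β = Q β α) (hJ : Q * weilJ 4 = weilJ 4 * Q)
    {k : ℕ} (K I : Fin k → Fin (2 * 4)) :
    (Q.submatrix K I).det =
      MvPolynomial.aeval (freeEntries Q) ((Matrix.of fun a b => symEntry (K a) (I b)).det) := by
  rw [AlgHom.map_det]
  congr 1
  ext a b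
  simp [aeval_symEntry hS hJ]

end Entries

end Summit.HodgeConjecture.HodgeConjecture.Theorems.TropicalHodgeBound
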